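import Summits.HodgeConjecture.HodgeConjecture.Theorems.MarkmanPartnerTransportRepresentsMinusTwoOfTranscEquivalent
import HarnessLib

/-!
# A `K3^{[2]}`-type fourfold has a K3 partner iff `NS(X)_ℚ` represents `−2` (orphan rung X3′ as a theorem)

Sub-problem `HodgeConjecture`, route MarkmanPartnerTransport, rung «PARTNERED ∕ ORPHAN `ρ = 3`» (X3′): for a marked
smooth projective fourfold `(X, φ, P, z)` of `K3^{[2]}`-type (`MarkedK3Sq`, clauses (m1)–(m6) of the route), the
following are equivalent (modulo `Huybrechts_K3_periodSurjective_projective` for ⇐ only):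

* `X` has a K3 PARTNER: a projective K3 surface `S` with a marking `(η, p, x)` and `g : H²(S) → H²(X)` with the
  route's clauses (g1)–(g7) (rational, Hodge, kills `N¹(S)`, image in and onto `T(X)_ℂ`, isometric on `T(S)`,
  rational lifts);
* `NS(X)_ℚ` REPRESENTS `−2`: some rational `φ⁻¹(v ⊗ 1) ∈ N¹(X)` has `q(v, v) = −2` (`RepresentsMinusTwo X φ` of the
  planner's sketch, unfolded).

⇐ is `exists_k3Partner_of_minusTwoClass` (prover 19716-p2 g4: one reflection + the period-surjectivity partner).
⇒ (this file, unconditional): a partner makes the rational transcendental lattice `(T_ℚ(X), q)` isometric to a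
subspace of `Λ_{K3} ⊗ ℚ` — choose rational cup-transcendental lifts of a `ℚ`-basis of `T_ℚ(X)` by (g7), read them
through `η` (`isRationalClass_iff_of_marking`), extend linearly; the map is isometric by (g5) and injective because
`q|T_ℚ` is non-degenerate — and then Witt cancellation (`exists_minusTwo_of_ratTransc_equivalent`:
`Λ_ℚ ⊥ ⟨−2⟩ ≅ N_ℚ ⊥ T_ℚ`, `Λ_ℚ ≅ W^⊥ ⊥ T_ℚ` ⇒ `N_ℚ ≅ ⟨−2⟩ ⊥ W^⊥`) produces the `(−2)`-class.

* `exists_ratTransc_isometry_of_partner` — partner ⇒ injective isometry `(T_ℚ(X), q) ↪ (ℚ²², Λ_{K3})`;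
* `equivalent_restrict_range_of_injective` — an injective isometry is an equivalence onto its range;
* `representsMinusTwo_of_partner` — (F);
* `exists_partner_iff_representsMinusTwo` — (I).

References: A. Beauville, J. Differential Geom. 18 (1983) §6 Prop. 6, §9 Rem. 1; D. Huybrechts, *Lectures on K3
Surfaces*, Ch. 3 Lemma 3.1, Ch. 6 Thm. 3.1, Ch. 7 Thm. 4.1; M. Knebusch, *Specialization of Quadratic and Symmetric
Bilinear Forms* (2010), Ch. 1 §1.2 Thm. 1.9; D. Morrison, Invent. Math. 75 (1984) §1–2.
-/

noncomputable section

set_option linter.dupNamespace false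

open Module QuadraticMap
open Literature.AlgebraicGeometry Literature.AlgebraicGeometry.Motives Literature.AlgebraicGeometry.HodgeTheory
open Literature.AlgebraicGeometry.Hyperkaehler Literature.AlgebraicGeometry.Surfaces
open Literature.AlgebraicTopology.SingularHomology
open Literature.LinearAlgebra.QuadraticForm

namespace Summit.HodgeConjecture.HodgeConjecture.Theorems.MarkmanPartnerTransport.PartnerLattice

/-- `MarkedK3Sq[X, φ, P, z]`: VERBATIM the `let MarkedK3Sq := …` binder of the route declarations of
MarkmanPartnerTransport (clauses (m1)–(m6)). Local notation only. -/
local notation3 (prettyPrint := false) "MarkedK3Sq[" X ", " φ ", " P ", " z "]" =>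
  (((IsIntegralClass P ∧ ∀ Q : complexBetti X (2 * 4), IsIntegralClass Q → ∃ n : ℤ, Q = n • P) ∧
    (∀ c : complexBetti X 2, IsIntegralClass c ↔ ∃ v : K3HilbertIndex → ℤ, φ c = fun i => (v i : ℂ)) ∧
    (∀ a : complexBetti X 2, cupPowTwo a 4 = ((3 : ℂ) * (k3HilbertForm 2 (φ a) (φ a)) ^ 2) • P) ∧
    (IsOfHodgeType 4 X 2 2 0 (LinearEquiv.symm φ z) ∧
      ∀ τ : complexBetti X 2, IsOfHodgeType 4 X 2 2 0 τ → ∃ t : ℂ, τ = t • LinearEquiv.symm φ z) ∧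
    (∀ c : complexBetti X 2, IsOfHodgeType 4 X 2 1 1 c ↔
      (k3HilbertForm 2 (φ c) z = 0 ∧ k3HilbertForm 2 (φ c) (star z) = 0)) ∧
    (k3HilbertForm 2 z z = 0 ∧ 0 < (k3HilbertForm 2 (star z) z).re)))

/-- `qQ` = the rational Beauville–Bogomolov form of `K3^{[2]}`-type on `ℚ²³` (as in `…PartnerExistenceLattice`). -/
local notation3 (prettyPrint := false) "qQ" => Matrix.toBilin' (Matrix.map (k3HilbertGram 2) (Int.cast : ℤ → ℚ))

/-! ### §1 An injective isometry is an equivalence onto its range -/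

section Range

variable {V V' : Type*} [AddCommGroup V] [Module ℚ V] [AddCommGroup V'] [Module ℚ V']

/-- An injective isometry `f : (V, Q) → (V', B')` of quadratic spaces makes `Q` equivalent to the restriction of
`B'` to the range of `f`. [folklore] -/
theorem equivalent_restrict_range_of_injective (Q : QuadraticForm ℚ V) (B' : LinearMap.BilinForm ℚ V')
    (f : Q →qᵢ B'.toQuadraticMap) (hf : Function.Injective f) :
    Q.Equivalent (B'.restrict (LinearMap.range f.toLinearMap)).toQuadraticMap := by
  have hf' : Function.Injective f.toLinearMap := fun a b h => hf h
  refine ⟨{ toLinearEquiv := LinearEquiv.ofInjective f.toLinearMap hf', map_app' := fun v => ?_ }⟩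
  rw [LinearMap.BilinMap.toQuadraticMap_apply]
  change B' ((LinearEquiv.ofInjective f.toLinearMap hf' v : LinearMap.range f.toLinearMap) : V')
      ((LinearEquiv.ofInjective f.toLinearMap hf' v : LinearMap.range f.toLinearMap) : V') = Q v
  rw [LinearEquiv.ofInjective_apply, ← f.map_app v, LinearMap.BilinMap.toQuadraticMap_apply]
  rfl

end Range

/-! ### §2 A partner embeds `T_ℚ(X)` isometrically into `Λ_{K3} ⊗ ℚ` -/

variable {X : SchemeOver ℂ} {φ : complexBetti X 2 ≃ₗ[ℂ] (K3HilbertIndex → ℂ)} {P : complexBetti X (2 * 4)}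
  {z : K3HilbertIndex → ℂ} {NQ : Submodule ℚ (K3HilbertIndex → ℚ)}
  {S : SchemeOver ℂ} {η : complexBetti S (2 * 1) ≃ₗ[ℂ] (K3Index → ℂ)}
  {g : complexBetti S (2 * 1) →ₗ[ℂ] complexBetti X 2}

/-- **A K3 partner embeds the rational transcendental lattice of `X` isometrically into `Λ_{K3} ⊗ ℚ`.** For a marked
smooth projective fourfold `(X, φ, P, z)`, a rational Néron–Severi space `NQ` (characterised by `hNQ`), a K3 surface
`S` marked by `η` (integral classes = `Λ`), and `g : H²(S) → H²(X)` isometric on cup-transcendental classes (g5) with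
rational transcendental lifts of rational transcendental classes (g7), there is an INJECTIVE ISOMETRY
`(T_ℚ(X), q) ↪ (ℚ²², Λ_{K3})`: lift a `ℚ`-basis of `T_ℚ = NQ^⊥` by (g7), read the lifts through `η`
(`isRationalClass_iff_of_marking`), extend linearly; isometric by (g5) on basis vectors and bilinearity, injective
since `q|T_ℚ` is non-degenerate (`restrict_ratTransc_nondegenerate`).
[cite: Huybrechts2016K3, Ch. 3 Lemma 3.1 and Ch. 6 Rem. 3.3] [cite: Beauville1983, §6 Prop. 6] -/
theorem exists_ratTransc_isometry_of_partner (hX : IsSmoothProjective 4 X) (hM : MarkedK3Sq[X, φ, P, z])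
    (hNQ : ∀ v, v ∈ NQ ↔ φ.symm (fun i => (v i : ℂ)) ∈ algebraicClasses X 1) (hS : IsK3Surface S)
    (hηint : ∀ c : complexBetti S (2 * 1), IsIntegralClass c ↔ ∃ v : K3Index → ℤ, η c = fun i => (v i : ℂ))
    (hg5 : ∀ a b, (∀ d ∈ algebraicClasses S 1, cupProduct (rfl : 2 * 1 + 2 * 1 = 2 * 2) a d = 0) →
      (∀ d ∈ algebraicClasses S 1, cupProduct (rfl : 2 * 1 + 2 * 1 = 2 * 2) b d = 0) →
      k3HilbertForm 2 (φ (g a)) (φ (g b)) = k3Form (η a) (η b))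
    (hg7 : ∀ y, (∀ d : complexBetti X 2, d ∈ algebraicClasses X 1 → k3HilbertForm 2 (φ y) (φ d) = 0) →
      IsRationalClass y →
      ∃ a, (∀ d ∈ algebraicClasses S 1, cupProduct (rfl : 2 * 1 + 2 * 1 = 2 * 2) a d = 0) ∧
        IsRationalClass a ∧ g a = y) :
    ∃ f : ((qQ).restrict ((qQ).orthogonal NQ)).toQuadraticMap →qᵢ k3FormRat.toQuadraticMap,
      Function.Injective f := by
  classical
  obtain ⟨-, hint, -⟩ := id hM
  set TQ : Submodule ℚ (K3HilbertIndex → ℚ) := (qQ).orthogonal NQ with hTQdef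
  -- a `ℚ`-basis of `T_ℚ` and, for each basis vector, a rational cup-transcendental lift through `g` read in `Λ_ℚ`
  let b := Module.finBasis ℚ TQ
  have hlift : ∀ k, ∃ a : complexBetti S (2 * 1), ∃ w : K3Index → ℚ,
      (∀ d ∈ algebraicClasses S 1, cupProduct (rfl : 2 * 1 + 2 * 1 = 2 * 2) a d = 0) ∧
        η a = (fun i => (w i : ℂ)) ∧ g a = φ.symm (fun i => ((b k : K3HilbertIndex → ℚ) i : ℂ)) := by
    intro k
    have hyT : ∀ d : complexBetti X 2, d ∈ algebraicClasses X 1 →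
        k3HilbertForm 2 (φ (φ.symm (fun i => ((b k : K3HilbertIndex → ℚ) i : ℂ)))) (φ d) = 0 := by
      intro d hd
      rw [LinearEquiv.apply_symm_apply]
      exact (ratCast_bbfTransc_iff_mem_orthogonal hX hint hNQ _).2 (b k).2 d hd
    have hyrat : IsRationalClass (φ.symm (fun i => ((b k : K3HilbertIndex → ℚ) i : ℂ))) :=
      (isRationalClass_iff_of_markedSq hX hint _).2 ⟨b k, by rw [LinearEquiv.apply_symm_apply]⟩
    obtain ⟨a, haT, harat, hga⟩ := hg7 _ hyT hyrat
    obtain ⟨w, hw⟩ := (isRationalClass_iff_of_marking hS η hηint a).1 harat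
    exact ⟨a, w, haT, hw, hga⟩
  choose a w haT haw hga using hlift
  -- the linear extension `f₀ : T_ℚ → Λ_ℚ`, `b k ↦ w k`
  set f₀ : TQ →ₗ[ℚ] (K3Index → ℚ) := b.constr ℚ w with hf₀def
  have hf₀b : ∀ k, f₀ (b k) = w k := fun k => by rw [hf₀def, Basis.constr_basis]
  -- isometric on basis vectors, by (g5)
  have hbasis : ∀ k l, k3FormRat (f₀ (b k)) (f₀ (b l)) =
      qQ (b k : K3HilbertIndex → ℚ) (b l : K3HilbertIndex → ℚ) := by
    intro k l
    rw [hf₀b, hf₀b]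
    have h : ((k3FormRat (w k) (w l) : ℚ) : ℂ) =
        ((qQ (b k : K3HilbertIndex → ℚ) (b l : K3HilbertIndex → ℚ) : ℚ) : ℂ) := by
      rw [← k3Form_ratCast, ← k3HilbertForm_ratCast, ← haw, ← haw, ← hg5 (a k) (a l) (haT k) (haT l), hga, hga,
        LinearEquiv.apply_symm_apply, LinearEquiv.apply_symm_apply]
    exact_mod_cast h
  -- hence isometric, by bilinearity
  have hiso : ∀ t t' : TQ, k3FormRat (f₀ t) (f₀ t') = qQ (t : K3HilbertIndex → ℚ) (t' : K3HilbertIndex → ℚ) := by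
    have hforms : (k3FormRat.compl₁₂ f₀ f₀ : LinearMap.BilinForm ℚ TQ) = (qQ).restrict TQ := by
      refine LinearMap.BilinForm.ext_basis b fun k l => ?_
      rw [LinearMap.compl₁₂_apply]
      exact hbasis k l
    intro t t'
    have h := LinearMap.congr_fun₂ hforms t t'
    rw [LinearMap.compl₁₂_apply] at h
    exact h
  -- and injective, since `q|T_ℚ` is non-degenerate
  have hsep : ((qQ).restrict TQ).SeparatingLeft := (restrict_ratTransc_nondegenerate hX hM hNQ).1
  have hinj : Function.Injective f₀ := by
    rw [injective_iff_map_eq_zero]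
    intro t ht
    refine hsep t fun t' => ?_
    change qQ (t : K3HilbertIndex → ℚ) (t' : K3HilbertIndex → ℚ) = 0
    rw [← hiso, ht, map_zero, LinearMap.zero_apply]
  refine ⟨{ toLinearMap := f₀, map_app' := fun t => ?_ }, hinj⟩
  rw [LinearMap.BilinMap.toQuadraticMap_apply, LinearMap.BilinMap.toQuadraticMap_apply]
  exact hiso t t

/-! ### §3 (F): a partner forces `NS(X)_ℚ` to represent `−2` -/

/-- **(F) A `K3^{[2]}`-type fourfold with a K3 partner has a rational algebraic class of square `−2`.** For a marked
smooth projective fourfold `(X, φ, P, z)`, a K3 surface `S` marked by `η`, and `g : H²(S) → H²(X)` with the route's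
clauses (g5) (isometric on cup-transcendental classes) and (g7) (rational transcendental lifts), `NS(X)_ℚ` represents
`−2`: the conclusion is `RepresentsMinusTwo X φ` of the rung «PARTNERED ∕ ORPHAN ρ = 3», unfolded. Proof:
`exists_ratTransc_isometry_of_partner` + Witt cancellation (`exists_minusTwo_of_ratTransc_equivalent`).
Unconditional. [cite: Beauville1983, §6 Prop. 6, §9 Rem. 1] [cite: Knebusch2010, Ch. 1 §1.2 Thm. 1.9]
[cite: Huybrechts2016K3, Ch. 3 Lemma 3.1] -/
theorem representsMinusTwo_of_partner (hX : IsSmoothProjective 4 X) (hM : MarkedK3Sq[X, φ, P, z])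
    (hS : IsK3Surface S)
    (hηint : ∀ c : complexBetti S (2 * 1), IsIntegralClass c ↔ ∃ v : K3Index → ℤ, η c = fun i => (v i : ℂ))
    (hg5 : ∀ a b, (∀ d ∈ algebraicClasses S 1, cupProduct (rfl : 2 * 1 + 2 * 1 = 2 * 2) a d = 0) →
      (∀ d ∈ algebraicClasses S 1, cupProduct (rfl : 2 * 1 + 2 * 1 = 2 * 2) b d = 0) →
      k3HilbertForm 2 (φ (g a)) (φ (g b)) = k3Form (η a) (η b))
    (hg7 : ∀ y, (∀ d : complexBetti X 2, d ∈ algebraicClasses X 1 → k3HilbertForm 2 (φ y) (φ d) = 0) →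
      IsRationalClass y →
      ∃ a, (∀ d ∈ algebraicClasses S 1, cupProduct (rfl : 2 * 1 + 2 * 1 = 2 * 2) a d = 0) ∧
        IsRationalClass a ∧ g a = y) :
    ∃ v : K3HilbertIndex → ℚ, φ.symm (fun i => ((v i : ℚ) : ℂ)) ∈ algebraicClasses X 1 ∧
      k3HilbertForm 2 (fun i => ((v i : ℚ) : ℂ)) (fun i => ((v i : ℚ) : ℂ)) = -2 := by
  obtain ⟨NQ, hNQ⟩ := exists_ratNeronSeveri (X := X) φ
  obtain ⟨f, hf⟩ := exists_ratTransc_isometry_of_partner hX hM hNQ hS hηint hg5 hg7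
  exact exists_minusTwo_of_ratTransc_equivalent hX hM hNQ (LinearMap.range f.toLinearMap)
    (equivalent_restrict_range_of_injective _ _ f hf)

/-! ### §4 (I): partner ⟺ `NS(X)_ℚ` represents `−2` -/

/-- **(I) Orphan rung X3′ as a theorem: a marked `K3^{[2]}`-type fourfold has a K3 partner iff `NS(X)_ℚ` represents
`−2`** (modulo `Huybrechts_K3_periodSurjective_projective`, used for ⇐ only). The left side is VERBATIM the
conclusion of `exists_k3Partner_of_minusTwoClass` (projective K3 surface `S`, marking `(η, p, x)` with all clauses,
`g` with (g1)–(g7), `ρ(X) ≤ ρ(S) + 1`); the right side is `RepresentsMinusTwo X φ` unfolded. ⇒ is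
`representsMinusTwo_of_partner` (uses (g5), (g7) and the marking only); ⇐ is `exists_k3Partner_of_minusTwoClass`.
Consequently the «ORPHAN ρ = 3» locus (no partner) is exactly «`NS(X)_ℚ` does not represent `−2`».
[cite: Huybrechts2016K3, Ch. 6 Thm. 3.1 and Rem. 3.3; Ch. 7 Thm. 4.1] [cite: Beauville1983, §9 Lemme 1 and Rem. 1]
[cite: Morrison1984, §1–2] [cite: Knebusch2010, Ch. 1 §1.2 Thm. 1.9] -/
theorem exists_partner_iff_representsMinusTwo (hP : Huybrechts_K3_periodSurjective_projective)
    (hX : IsSmoothProjective 4 X) (hM : MarkedK3Sq[X, φ, P, z]) :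
    (∃ (S : SchemeOver ℂ) (η : complexBetti S (2 * 1) ≃ₗ[ℂ] (K3Index → ℂ)) (p : complexBetti S (2 * 2))
      (x : K3Index → ℂ) (g : complexBetti S (2 * 1) →ₗ[ℂ] complexBetti X 2),
      IsK3Surface S ∧
      (p ≠ 0 ∧ (IsIntegralClass p ∧ (∀ q : complexBetti S (2 * 2), IsIntegralClass q → ∃ n : ℤ, q = n • p) ∧
        (∀ c : complexBetti S (2 * 1), IsIntegralClass c ↔ ∃ v : K3Index → ℤ, η c = fun i => (v i : ℂ)) ∧
        (∀ a b : complexBetti S (2 * 1), cupProduct (rfl : 2 * 1 + 2 * 1 = 2 * 2) a b = k3Form (η a) (η b) • p) ∧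
        IsOfHodgeType 2 S (2 * 1) 2 0 (LinearEquiv.symm η x) ∧
        (∀ τ : complexBetti S (2 * 1), IsOfHodgeType 2 S (2 * 1) 2 0 τ → ∃ t : ℂ, τ = t • LinearEquiv.symm η x)) ∧
        (k3Form x x = 0 ∧ 0 < (k3Form (star x) x).re ∧ ∃ u : K3Index → ℤ,
          k3Form (fun i => (u i : ℂ)) x = 0 ∧ 0 < ∑ i, ∑ j, u i * k3Gram i j * u j)) ∧
      ((∀ a, IsRationalClass a → IsRationalClass (g a)) ∧
        (∀ (i j : ℕ) a, IsOfHodgeType 2 S (2 * 1) i j a → IsOfHodgeType 4 X 2 i j (g a)) ∧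
        (∀ d ∈ algebraicClasses S 1, g d = 0) ∧
        (∀ a, ∀ d : complexBetti X 2, d ∈ algebraicClasses X 1 → k3HilbertForm 2 (φ (g a)) (φ d) = 0) ∧
        (∀ a b, (∀ d ∈ algebraicClasses S 1, cupProduct (rfl : 2 * 1 + 2 * 1 = 2 * 2) a d = 0) →
          (∀ d ∈ algebraicClasses S 1, cupProduct (rfl : 2 * 1 + 2 * 1 = 2 * 2) b d = 0) →
          k3HilbertForm 2 (φ (g a)) (φ (g b)) = k3Form (η a) (η b)) ∧
        (∀ y, (∀ d : complexBetti X 2, d ∈ algebraicClasses X 1 → k3HilbertForm 2 (φ y) (φ d) = 0) →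
          ∃ a, (∀ d ∈ algebraicClasses S 1, cupProduct (rfl : 2 * 1 + 2 * 1 = 2 * 2) a d = 0) ∧ g a = y) ∧
        (∀ y, (∀ d : complexBetti X 2, d ∈ algebraicClasses X 1 → k3HilbertForm 2 (φ y) (φ d) = 0) →
          IsRationalClass y →
          ∃ a, (∀ d ∈ algebraicClasses S 1, cupProduct (rfl : 2 * 1 + 2 * 1 = 2 * 2) a d = 0) ∧
            IsRationalClass a ∧ g a = y)) ∧
      Module.finrank ℂ (algebraicClasses X 1) ≤ Module.finrank ℂ (algebraicClasses S 1) + 1) ↔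
    ∃ v : K3HilbertIndex → ℚ, φ.symm (fun i => ((v i : ℚ) : ℂ)) ∈ algebraicClasses X 1 ∧
      k3HilbertForm 2 (fun i => ((v i : ℚ) : ℂ)) (fun i => ((v i : ℚ) : ℂ)) = -2 := by
  obtain ⟨-, hint, -⟩ := id hM
  constructor
  · rintro ⟨S, η, p, x, g, hS, ⟨-, ⟨-, -, hηint, -⟩, -⟩, ⟨-, -, -, -, hg5, -, hg7⟩, -⟩
    exact representsMinusTwo_of_partner hX hM hS hηint hg5 hg7
  · rintro ⟨v, hv, hq⟩
    refine exists_k3Partner_of_minusTwoClass hP hX hM hv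
      ((isRationalClass_iff_of_markedSq hX hint _).2 ⟨v, by rw [LinearEquiv.apply_symm_apply]⟩) ?_
    rw [LinearEquiv.apply_symm_apply]
    exact hq

end Summit.HodgeConjecture.HodgeConjecture.Theorems.MarkmanPartnerTransport.PartnerLattice

end
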